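import Mathlib
import HarnessLib
import Summits.ResolutionOfSingularities.ResolutionOfSingularities.Theorems.HomologicalConductorNoZenoBirthDefs

/-!
# Route `HomologicalConductor`, crux `NoZeno` (stmt-ResolutionOfSingularities-16483; of record since route
# rev 4: `NoZenoR`, stmt-ResolutionOfSingularities-19943), line `sandwich-cluster` — definitions

OURS (cell res-hironaka, crux chain W4.4). Nothing here is a statement of the manuscript under review
(Hironaka 2017); AI-written, weaker than expert review.

The crux planner's SECOND-LAYER SPLIT of the open surface core `stub_sandwichedTermination` of the
registered skeleton (line `birth`, v9, sha16 36ec94206bc35d0f) is the line `sandwich-cluster`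
(CRUX-PLAN W4.4 v2 §2, planner res-L0-w44-plan-1; typed file `SandwichCluster.lean`, sha16
1b03eebffb9f78d9, attached as evidence #1 on stmt-19943 and #48 on stmt-16483). Its four stubs
`stub_basePtsFinite`, `stub_regularOfBasePtsEmpty`, `stub_caPrincipalUpstairs` (= (Q_val), the open core)
and `stub_basePtsStrictAnti` are statements about the objects named below. As for the line `birth`
(`HomologicalConductorNoZenoBirthDefs.lean`), the vocabulary is filed HERE, under `Theorems/`, so that the
stubs and their helper lemmas can be stated BY NAME in `Theorems/` files; every body below is copied
VERBATIM from the planner's file (only docstrings are edited), so that the line file re-elaborates over these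
names by `open … SandwichCluster` alone.

* `ordSet S`      — the order pseudo-valuation ring of a `k`-subalgebra `S` of `K`, as a SET: quotients `a/b`,
                    `a, b ∈ Jⁿ`, `b ∉ Jⁿ⁺¹`, `J` the Jacobson radical of `S`. For a REGULAR local `S` with
                    `Frac S = K` this is the valuation ring of the `𝔪_S`-adic order valuation (the prime
                    divisor `E_q` of the infinitely near point `q = S`): PROVED in
                    `HomologicalConductorNoZenoOrdValuation.lean` (`exists_valuationSubring_coe_eq_ordSet`).
* `Dominates V T` — `T ⊆ V` and elements of `T` invertible in `V` are invertible in `T` (the route's own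
                    domination clause, cf. the kernel binder of `NoZeno`).
* `basePts R T`   — the regular 2-dimensional local `S ⊇ R` NOT containing `T` whose `ordSet` dominates `T`
                    (for `T` sandwiched over the regular `R`: the vertices of the minimal resolution graph of
                    `T`, Zariski's dictionary; `Set.ncard` of it is the descent quantity `N(T)` of the line).
* `SandwichCtx O A R m₀` — the datum clauses of the crux + `tr.deg_k K = 2` + the sandwich datum
                    (`R` regular, `Frac R = K`, `R ⊆ O`, `loc O R = R`, `R ≤ T_m` for `m ≥ m₀`), WITHOUT the
                    valuation-kernel clauses.

No theorem of this file concludes anything about the crux; `mem_ordSet_iff_exists`, `dominates_iff`,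
`mem_basePts_iff`, `sandwichCtx_iff` are `Iff.rfl` unfoldings for rewriting.

References (for the dictionary the names encode; nothing of it is asserted here): M. Spivakovsky,
*Sandwiched singularities and desingularization of surfaces by normalized Nash transformations*, Ann. of
Math. 131 (1990) §§I–II [`Spivakovsky1990`]; J. Lipman, *Rational singularities…*, Publ. IHÉS 36 (1969)
§§1, 12, 18 [`Lipman1969`]; O. Zariski, P. Samuel, *Commutative Algebra* II (1960), Ch. VIII §1 and App. 5
[`ZariskiSamuel1960`].
-/

noncomputable section

-- single-problem summit: the doubled namespace component `ResolutionOfSingularities` is forced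
set_option linter.dupNamespace false

namespace Summit.ResolutionOfSingularities.ResolutionOfSingularities.Theorems.NoZeno.SandwichCluster

open Summit.ResolutionOfSingularities.ResolutionOfSingularities.Theses.HomologicalConductor
open Summit.ResolutionOfSingularities.ResolutionOfSingularities.Theorems.NoZeno.Birth

variable {k K : Type} [Field k] [Field K] [Algebra k K]

/-- The ORDER pseudo-valuation ring of a `k`-subalgebra `S` of `K`, as a set: quotients `a * b⁻¹`
with `a, b ∈ Jⁿ`, `b ∉ Jⁿ⁺¹` for some `n`, `J` the Jacobson radical of `S` (`= 𝔪_S` when `S` is local).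
For a REGULAR local `S` with `Frac S = K` this is the valuation ring of the `𝔪_S`-adic order valuation
(Zariski–Samuel VIII §1 Thm. 1) — the prime divisor `E_q` of the infinitely near point `q = S`; for
non-local or non-regular `S` it is just this set (no claim). Verbatim the planner's `ordSet`
(CRUX-PLAN W4.4 v2 §2). [cite: ZariskiSamuel1960, Ch. VIII §1 Thm. 1] -/
def ordSet (S : Subalgebra k K) : Set K :=
  {x : K | ∃ n : ℕ, ∃ a b : ↥S, a ∈ ((⊥ : Ideal ↥S).jacobson) ^ n ∧ b ∈ ((⊥ : Ideal ↥S).jacobson) ^ n ∧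
      b ∉ ((⊥ : Ideal ↥S).jacobson) ^ (n + 1) ∧ x = (a : K) * ((b : K))⁻¹}

/-- `V` DOMINATES `T`: `T ⊆ V` and every element of `T` invertible in `V` is invertible in `T` (for local
`T ⊆ V` with `V` local: `𝔪_T = 𝔪_V ∩ T`; the same clause shape as the kernel binder of the crux).
Verbatim the planner's `Dominates`. [folklore] -/
def Dominates (V : Set K) (T : Subalgebra k K) : Prop :=
  ∀ t : K, t ∈ T → t ∈ V ∧ (t⁻¹ ∈ V → t⁻¹ ∈ T)

/-- BASE POINTS of `T` over `R`: the regular 2-dimensional local `k`-subalgebras `S ⊇ R` of `K` NOT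
containing `T` whose order pseudo-valuation ring `ordSet S` dominates `T`. For `T` a sandwiched surface
singularity over the regular `R` (a local ring of the normalised blow-up of a complete `𝔪_R`-primary
ideal `I`) these are, by Zariski's dictionary, the non-dicritical base points `q` of `I` with `E_q` centred
at `T`, i.e. the vertices of the minimal resolution graph of `T`; `Set.ncard` of this set is the line's
descent quantity `N(T)`. Verbatim the planner's `basePts`; the dictionary itself is NOT asserted here.
[cite: Spivakovsky1990, §II] -/
def basePts (R T : Subalgebra k K) : Set (Subalgebra k K) :=
  {S | R ≤ S ∧ IsRegularLocalRing ↥S ∧ ringKrullDim ↥S = 2 ∧ ¬ T ≤ S ∧ Dominates (ordSet S) T}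

/-- The SANDWICH CONTEXT of the surface core `stub_sandwichedTermination` minus its valuation-kernel
clauses: the datum clauses of the crux (`k ⊆ O`, `A` finitely generated with `Frac A = K`, `A ⊆ O`),
`tr.deg_k K = 2`, and the sandwich datum — `R` regular with `Frac R = K`, `R ⊆ O`, `loc O R = R`, and
`R ≤ tower O A m` for all `m ≥ m₀`. Verbatim the planner's `SandwichCtx`. [folklore] -/
def SandwichCtx (O : ValuationSubring K) (A R : Subalgebra k K) (m₀ : ℕ) : Prop :=
  (∀ c : k, algebraMap k K c ∈ O) ∧ A.FG ∧ IsFractionRing ↥A K ∧ A.toSubring ≤ O.toSubring ∧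
  Algebra.trdeg k K = 2 ∧ IsRegularLocalRing ↥R ∧ IsFractionRing ↥R K ∧
  R.toSubring ≤ O.toSubring ∧ loc O R = R ∧ ∀ m : ℕ, m₀ ≤ m → R ≤ tower O A m

/-! ## Unfoldings (`Iff.rfl`) -/

/-- Unfolding of `ordSet`-membership. [folklore] -/
theorem mem_ordSet_iff_exists (S : Subalgebra k K) {x : K} :
    x ∈ ordSet S ↔ ∃ n : ℕ, ∃ a b : ↥S, a ∈ ((⊥ : Ideal ↥S).jacobson) ^ n ∧
      b ∈ ((⊥ : Ideal ↥S).jacobson) ^ n ∧ b ∉ ((⊥ : Ideal ↥S).jacobson) ^ (n + 1) ∧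
      x = (a : K) * ((b : K))⁻¹ :=
  Iff.rfl

/-- Unfolding of `Dominates`. [folklore] -/
theorem dominates_iff (V : Set K) (T : Subalgebra k K) :
    Dominates V T ↔ ∀ t : K, t ∈ T → t ∈ V ∧ (t⁻¹ ∈ V → t⁻¹ ∈ T) :=
  Iff.rfl

/-- Unfolding of `basePts`-membership. [folklore] -/
theorem mem_basePts_iff (R T S : Subalgebra k K) :
    S ∈ basePts R T ↔
      R ≤ S ∧ IsRegularLocalRing ↥S ∧ ringKrullDim ↥S = 2 ∧ ¬ T ≤ S ∧ Dominates (ordSet S) T :=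
  Iff.rfl

/-- Unfolding of `SandwichCtx`. [folklore] -/
theorem sandwichCtx_iff (O : ValuationSubring K) (A R : Subalgebra k K) (m₀ : ℕ) :
    SandwichCtx O A R m₀ ↔
      (∀ c : k, algebraMap k K c ∈ O) ∧ A.FG ∧ IsFractionRing ↥A K ∧ A.toSubring ≤ O.toSubring ∧
      Algebra.trdeg k K = 2 ∧ IsRegularLocalRing ↥R ∧ IsFractionRing ↥R K ∧
      R.toSubring ≤ O.toSubring ∧ loc O R = R ∧ ∀ m : ℕ, m₀ ≤ m → R ≤ tower O A m :=
  Iff.rfl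

end Summit.ResolutionOfSingularities.ResolutionOfSingularities.Theorems.NoZeno.SandwichCluster

end
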